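import Summits.QuantumFields.YangMills.Theorems.UnitScaleTiltProp7SectET3NormG
import Summits.QuantumFields.YangMills.Theorems.UnitScaleTiltProp7SectET3Geometry
import HarnessLib

/-!
# Route `UnitScaleTilt`, crux «MinimiserStabilityRegPr» (stmt-QuantumFields-19200, v10 stub EX, route (α), node N06(d = 3)) — layer (S3-b), the `norm_H₁` HALF OF THE KNIT:
# **`SectEDatum.norm_H₁` ∕ the displayed `norm_H₁` row of `Cmin_of_P6T3_chart_growth_pd` FROM `B9.Thm312Printed`'S KERNEL CLAUSE (3.133) — THE UNITS ∕ SUMMATION READING**,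
# generic and at the T³ member of record (`geo9K`, `bgT3`, `memberIdx`, the route's field read by `cfgV1OfT3`, print's regular space `RegPr` through the class-transfer row
# `ClassTransferT3`)

Cell `ym3-torus` (HUMAN RULING D-0037, YM ladder rung R3 — NOT the Clay problem), width seat ym-ust-20520-w1 g4 (OWNER ym3-torus-plan g26 ACK 3 (b): «the `norm_H₁` global-twin
reading of `Ineq3133` as `SectEDatum.norm_H₁` (units∕summation reading)»).  Count-neutral helper (`--supports stmt-QuantumFields-19200 --as helper`); registry untouched; THEOREMS
ONLY (0 `def`, 0 `sorry`); NOTHING of [Balaban1985BackgroundPropagators] is asserted.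

THE PRINT.  [Balaban1985Variational] (103) p. 293: *«|H₁B| < B₀2dLC₁ε₁(L^jη)^{−1}, |∇H₁B| < B₀2dLC₁ε₁(L^jη)^{−2} on Ω_j»* (from *«|B| < 2dLC₁ε₁»* and Theorem 3.12 of [5]) —
the field `B11Prop6Concrete.SectEDatum.norm_H₁` and the displayed row `norm_H₁` of ★w2-19200 g2's `Prop7CminOfP6T3Pd.Cmin_of_P6T3_chart_growth_pd` (`RegPr … e U₀ → e ≤ α → ∀ b,
‖H₁f i U₀ b‖ ≤ B₀‖b‖`, `H₁f i U₀ : (β i → M₂(ℂ)) →L[ℂ] Space115 …` OPAQUE).  [Balaban1985BackgroundPropagators] (3.133) p. 422: *«|H_{μν}(x, y′)|, |∇H_{μν}(x, y′)|, … ≦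
O(1)[1, (L^jη)^{−1}, …](L^{j′}η)^{−d}e^{−(1∕2)δ₁d(y,y′)}, for x ∈ Δ(y), … y ∈ Λ_j, y′ ∈ Λ_{j′}»* — the H-clause `B9.Ineq3133 d Hk B₀ Bβ δ₀ U` of `B9.Thm312Printed` (Thm 3.12 p. 423),
a KERNEL bound; [Balaban1984PropagatorsII] Lemma 2.1 (2.61) p. 234: *«sup_{y∈𝔅} Σ_{y′∈𝔅} e^{−αδ₀d(y,y′)} ≤ c₁(α)»* (`B9Ineq349Whole.RowSum261`, PROVED at `geo9K`:
`B9GeoLemma21KLevelV1.rowSum261_geo9K`); (115) p. 294 of [Balaban1985Variational]: `‖A‖₍₁₁₅₎ = max{|A|₍₋₁₎, |∇_{U₀}A|₍₋₂₎}` with `|f|_{(−n)} = sup_x (L^{j(x)}η)^n‖f(x)‖`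
(`B11Eq115Space.levWeight`, `JetSup.norm_le_iff_pointwise`).

WHY A SEPARATE FILE (the LOCATED difference with the `norm_G` half, ★w1 g3's `Prop7SectET3NormG`).  Theorem 3.13's (3.47) is an OPERATOR-NORM clause (`glob n U λ γ ≤ B₀·wNorm γ λ`),
so `norm_G` is two inequalities out of one ∃-package.  Theorem 3.12's H-clause is a bound on KERNEL ENTRIES `Hk.e n U y y′` (`B9.HKernel` carries reals — «sup_{x∈Δ(y)}|H(x,y′)|»,
«sup_{x∈Δ(y)}|∇H(x,y′)|»); an operator bound needs two more rows, neither displayed in print: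
 (U) UNITS — the operator's input sum over the coarse lattice `𝔅` carries the scaled volume `(L^{j′}η)^{+d}` of the η-scale pairing (the tree's own conventions: the test-vector
     clause `|A b x| ≤ c·len(y′)^d` of `B9CoRealizesHRel.CoRealizesHRel.obs`, the weight `vol g d y′ = len(y′)^d` of `B11KernelDictionary.kernelOp`), which CANCELS (3.133)'s
     `(L^{j′}η)^{−d}`; and the (115) weights `(L^{j}η)^{n+1}` against (3.133)'s `(L^{j}η)^{−n}` leave one factor `L^{j}η ≤ 1` (`= 1` at the one-level T³ members) — typed
     below as a free exponent `s` with `len(y)^s ≤ 1` (`s = 0`: nothing to check; `s = 1`: the (115) jet reading);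
 (Σ) SUMMATION — the row sum `Σ_{y′} e^{−(δ₀∕2)d(y,y′)} ≤ c` = (2.61) at the rate `δ₀∕2`; since `δ₀` sits INSIDE `Thm312Printed`'s ∃, the family statement consumes (2.61) AT EVERY
     RATE under an M-threshold — exactly `RowSum261 geo` — and the M-threshold of the conclusion is `max M₄ M_L(δ₀∕2)`.
The ℝ-valued, block-localised precedent of the same summation is lit-balaban's `B11KernelDictionary` §3∕§9 (`opBound_of_hasMaj`, `hasMaj_of_B9_ineq3133`, `ineq46_of_kernelBounds`
— the C-IF-03 edge for (46)∕(130) over `B11SectG.BlockNorm`s, with the (129) rescaling and a level-gap exchange); THIS FILE states the edge in the CONSUMER'S currency: an OPAQUE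
operator family between Mathlib (semi)normed groups (`Space115` included), read by the kernel entries through ONE displayed pin `hpin` — the dual of `CoRealizesHRel.obs` («the
operator is dominated by its (3.133) entries») —, at the level of the whole ∃-package `B9.Thm312Printed`, and at the T³ member of record.  Nothing of the dictionary is restated.

WHAT IS PROVED (ns `…Theorems.Prop7SectET3NormH1`).
* §1 ONE MEMBER, ONE U: ★ `sum_e_mul_len_le_of_ineq3133` — `Ineq3133 d Hk C Cβ δ₁ U ∧ 0 ≤ C ∧ 0 < len ∧ (Σ_{y′} e^{−(δ₁∕2)d(y,y′)} ≤ c)` ⟹ `Σ_{y′} Hk.e n U y y′·len(y′)^d ≤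
  C·len(y)^{−n}·c` (the (U)+(Σ) row); ★ `opNorm_le_of_ineq3133` — plus the pin ⟹ `‖Hop b‖ ≤ C·c·‖b‖`.
* §2 THE FAMILY: ★★ `normH_of_thm312Printed` — `B9.Thm312Printed d c35 geo bg GD G₁ H H₁ …` + `RowSum261 geo` + `0 < len` + the pin for a selected H-kernel `Hk i ∈ {H i, H₁ i}`
  ⟹ `∃ M₄ a₀ B₀ > 0, ∀ i, M₄ ≤ M_i → ∀ α₀ > 0, M_i·α₀ ≤ a₀ → ∀ U ∈ (3.35) ∩ (3.36), ∀ b, ‖Hop i U b‖ ≤ B₀‖b‖` — the text of `SectEDatum.norm_H₁` ∕ (103); ★ `normH_of_thm312Printed_jet`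
  — the same at `Y := Space115 Lr η lev₀ lev₁ (D i U)` from the two POINTWISE pins («x ∈ Δ(σ₀ x)», «p ∈ Δ(σ₁ p)» as maps) and `len ≤ 1` ((115) verbatim, `s = 1`).
* §3 AT THE T³ MEMBER OF RECORD: ★★ `normH₁_row_of_t312_classTransfer` — §2 at `(geo9K, bgT3) ∘ KIdx 2 ℓ hd3 hL 1 1` with (Σ) DISCHARGED by `rowSum261_geo9K` and `0 < len` by
  `geoOK_geo9K`, through ★w1 g2's class-transfer row `ClassTransferT3 ℓ hL c35` (`RegPr(L³B₃ε₁) ⊂ (3.35) ∧ (3.36)` at `memberIdx`) and `regPr_mono` ⟹ for every member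
  `memberIdx ℓ hL hℓ m hm n K a' R …` whose big-block size `M = L·L^{a'}` clears the threshold and every `e ≤ a₀ ∕ (L·L^{a'})`:
  `RegPr ⟨ℓ+1, hL, m, hm⟩ n K e U₀ → ∀ b, ‖Hop (memberIdx …) (cfgV1OfT3 U₀) b‖ ≤ B₀‖b‖` — the displayed `norm_H₁` row's SHAPE; the twin of ✓ `normG_row_of_t313_classTransfer`.
HONEST SCOPE: bookkeeping (one finite sum, one cancellation of scale factors, one monotonicity of `RegPr`); no estimate of [B9] asserted; the curved letter `H₁f` of the route stays OPAQUE
until a supplier DEFINES it and proves the pin (that is the (L6)-letter of NE9, not this file); N06(d = 3) is NOT discharged; nothing here claims EX, the crux, V3∕R3, d = 4 or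
the mass gap; YM₃ on T³ is ladder rung R3, not the Clay problem.

References: T. Bałaban, CMP 99 (1985) 389–434 [Balaban1985BackgroundPropagators] ((3.35)–(3.36) p.396, (3.41) p.397, (3.133) p.422, Thm 3.12 pp.421–423); CMP 102 (1985) 277–309
[Balaban1985Variational] ((14) p.280, (103) p.293, (115) p.294, (117) p.295); CMP 96 (1984) 223–250 [Balaban1984PropagatorsII] (Lemma 2.1 (2.61) p.234); CMP 99 (1985) 75–102
[Balaban1985RegularSpaces] ((1.33) p.82).
-/

set_option autoImplicit false

noncomputable section

open scoped Matrix.Norms.L2Operator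

namespace Summit.QuantumFields.YangMills.Theorems.Prop7SectET3NormH1

open Literature.MathematicalPhysics.QuantumFieldTheory.Balaban1983to89
open Literature.MathematicalPhysics.QuantumFieldTheory.Balaban1983to89.T3ContinuumYM3Torus
open Literature.MathematicalPhysics.QuantumFieldTheory.Balaban1983to89.T3PrintedRegularMinimiser (RegPr)
open Literature.MathematicalPhysics.QuantumFieldTheory.Balaban1983to89.T3PrintedMinimiserExistence (regPr_mono)
open Literature.MathematicalPhysics.QuantumFieldTheory.Balaban1983to89.B6KLevelCensusIndexV1 (KIdx kGeo)
open Literature.MathematicalPhysics.QuantumFieldTheory.Balaban1983to89.B6GlobalChartV1 (PV)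
open Literature.MathematicalPhysics.QuantumFieldTheory.Balaban1983to89.B9GeoNormsKLevelV1 (geo9K)
open Literature.MathematicalPhysics.QuantumFieldTheory.Balaban1983to89.B9GeoLemma21KLevelV1 (rowSum261_geo9K)
open Literature.MathematicalPhysics.QuantumFieldTheory.Balaban1983to89.B9Ineq349Whole (RowSum261)
open Literature.MathematicalPhysics.QuantumFieldTheory.Balaban1983to89.B11Eq115Space (NegSup NegSize Space115 JetSup levWeight)
open Summit.QuantumFields.YangMills.Theorems.Prop7SectET3Members (hd3 memberIdx)
open Summit.QuantumFields.YangMills.Theorems.Prop7SectET3BgClass (bgT3 cfgV1OfT3 ClassTransferT3)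
open Summit.QuantumFields.YangMills.Theorems.Prop7SectET3Geometry (geoOK_geo9K)
open Summit.QuantumFields.YangMills.Theorems.Prop7SectET3NormG (geo9K_M_memberIdx)

/-! ## §1 One member, one configuration: the (U)+(Σ) row and the operator bound from the pin -/

section OneMember

variable {g : B9.Geometry} {B : B9.Backgrounds} [Fintype g.Site]

/-- ★ **THE UNITS ∕ SUMMATION ROW.**  (3.133) at one `U` (`Ineq3133 d Hk C Cβ δ₁ U`: `Hk.e n U y y′ ≤ C·len(y)^{−n}·len(y′)^{−d}·e^{−(δ₁∕2)d(y,y′)}`, n ∈ {0, 1}) with `0 ≤ C`,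
positive scale lengths `len = L^{j}η` and the row sum (2.61) at the rate `δ₁∕2` (`Σ_{y′} e^{−(δ₁∕2)d(y,y′)} ≤ c`) give, for every `n` and every coarse site `y`:
`Σ_{y′} Hk.e n U y y′ · len(y′)^{d} ≤ C · len(y)^{−n} · c` — the volume `len(y′)^{+d}` of the η-scale pairing cancels the kernel's `len(y′)^{−d}` term by term, then (2.61) sums
the exponentials. [cite: Balaban1985BackgroundPropagators, (3.133) p.422; Balaban1984PropagatorsII, (2.61) p.234] -/
theorem sum_e_mul_len_le_of_ineq3133 {d : ℕ} {Hk : B9.HKernel g B} {C : ℝ} {Cβ : ℝ → ℝ} {δ₁ : ℝ} {U : B.Cfg}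
    (h : B9.Ineq3133 d Hk C Cβ δ₁ U) (hC : 0 ≤ C) (hlen : ∀ y : g.Site, 0 < g.len y) {c : ℝ}
    (hrow : ∀ y : g.Site, ∑ y' : g.Site, Real.exp (-(δ₁ / 2 * g.dist y y')) ≤ c) (n : Fin 2) (y : g.Site) :
    ∑ y' : g.Site, Hk.e n U y y' * g.len y' ^ (d : ℝ) ≤ C * g.len y ^ (-(n : ℝ)) * c := by
  have hterm : ∀ y' : g.Site,
      Hk.e n U y y' * g.len y' ^ (d : ℝ) ≤ C * g.len y ^ (-(n : ℝ)) * Real.exp (-(δ₁ / 2 * g.dist y y')) := by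
    intro y'
    have hl : 0 < g.len y' := hlen y'
    calc Hk.e n U y y' * g.len y' ^ (d : ℝ)
        ≤ (C * g.len y ^ (-(n : ℝ)) * g.len y' ^ (-(d : ℝ)) * Real.exp (-(δ₁ / 2 * g.dist y y'))) * g.len y' ^ (d : ℝ) :=
          mul_le_mul_of_nonneg_right (h.1 n y y') (Real.rpow_nonneg hl.le _)
      _ = C * g.len y ^ (-(n : ℝ)) * Real.exp (-(δ₁ / 2 * g.dist y y')) * (g.len y' ^ (-(d : ℝ)) * g.len y' ^ (d : ℝ)) := by ring
      _ = C * g.len y ^ (-(n : ℝ)) * Real.exp (-(δ₁ / 2 * g.dist y y')) := by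
          rw [← Real.rpow_add hl, neg_add_cancel, Real.rpow_zero, mul_one]
  calc ∑ y' : g.Site, Hk.e n U y y' * g.len y' ^ (d : ℝ)
      ≤ ∑ y' : g.Site, C * g.len y ^ (-(n : ℝ)) * Real.exp (-(δ₁ / 2 * g.dist y y')) := Finset.sum_le_sum fun y' _ => hterm y'
    _ = C * g.len y ^ (-(n : ℝ)) * ∑ y' : g.Site, Real.exp (-(δ₁ / 2 * g.dist y y')) := by rw [Finset.mul_sum]
    _ ≤ C * g.len y ^ (-(n : ℝ)) * c := mul_le_mul_of_nonneg_left (hrow y) (mul_nonneg hC (Real.rpow_nonneg (hlen y).le _))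

/-- ★ **THE OPERATOR BOUND AT ONE MEMBER AND ONE U.**  Data: a map `Hop : X → Y` between seminormed groups (at the T³ instance `H₁(U₀) : (𝔅 → M₂(ℂ)) → (115)_{U₀}`) and THE PIN
`hpin` — the dual of the tree's co-reading `CoRealizesHRel.obs`: «`‖Hop b‖ ≤ c` as soon as, for every entry index `n` and every coarse site `y`, the weighted row
`len(y)^{n+s} · (Σ_{y′} Hk.e n U y y′ · len(y′)^{d}) · ‖b‖` is `≤ c`» (the operator is read by its (3.133) entries: output near `y` weighted by `len(y)^{n+s}`, input summed with the
pairing volume `len(y′)^{d}`); `s` is the spare weight exponent with `len^s ≤ 1` (`s = 0` no condition, `s = 1` the (115) weights).  With §1's row: `‖Hop b‖ ≤ C·c·‖b‖`.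
[cite: Balaban1985BackgroundPropagators, (3.133) p.422; Balaban1985Variational, (103) p.293; Balaban1984PropagatorsII, (2.61) p.234] -/
theorem opNorm_le_of_ineq3133 {d : ℕ} {Hk : B9.HKernel g B} {C : ℝ} {Cβ : ℝ → ℝ} {δ₁ : ℝ} {U : B.Cfg}
    (h : B9.Ineq3133 d Hk C Cβ δ₁ U) (hC : 0 ≤ C) (hlen : ∀ y : g.Site, 0 < g.len y) {c : ℝ} (hc : 0 ≤ c)
    (hrow : ∀ y : g.Site, ∑ y' : g.Site, Real.exp (-(δ₁ / 2 * g.dist y y')) ≤ c)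
    {X Y : Type*} [SeminormedAddCommGroup X] [SeminormedAddCommGroup Y] (Hop : X → Y) (s : ℝ) (hls : ∀ y : g.Site, g.len y ^ s ≤ 1)
    (hpin : ∀ (b : X) (c' : ℝ), 0 ≤ c' →
      (∀ (n : Fin 2) (y : g.Site), g.len y ^ ((n : ℝ) + s) * (∑ y' : g.Site, Hk.e n U y y' * g.len y' ^ (d : ℝ)) * ‖b‖ ≤ c') → ‖Hop b‖ ≤ c')
    (b : X) : ‖Hop b‖ ≤ C * c * ‖b‖ := by
  have hCcb : 0 ≤ C * c * ‖b‖ := mul_nonneg (mul_nonneg hC hc) (norm_nonneg b)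
  refine hpin b _ hCcb fun n y => ?_
  have hl : 0 < g.len y := hlen y
  have hS := sum_e_mul_len_le_of_ineq3133 h hC hlen hrow n y
  have hn : g.len y ^ (n : ℝ) * (∑ y' : g.Site, Hk.e n U y y' * g.len y' ^ (d : ℝ)) * ‖b‖ ≤ C * c * ‖b‖ := by
    calc g.len y ^ (n : ℝ) * (∑ y' : g.Site, Hk.e n U y y' * g.len y' ^ (d : ℝ)) * ‖b‖
        ≤ g.len y ^ (n : ℝ) * (C * g.len y ^ (-(n : ℝ)) * c) * ‖b‖ :=
          mul_le_mul_of_nonneg_right (mul_le_mul_of_nonneg_left hS (Real.rpow_nonneg hl.le _)) (norm_nonneg b)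
      _ = (g.len y ^ (n : ℝ) * g.len y ^ (-(n : ℝ))) * (C * c * ‖b‖) := by ring
      _ = C * c * ‖b‖ := by rw [← Real.rpow_add hl, add_neg_cancel, Real.rpow_zero, one_mul]
  calc g.len y ^ ((n : ℝ) + s) * (∑ y' : g.Site, Hk.e n U y y' * g.len y' ^ (d : ℝ)) * ‖b‖
      = g.len y ^ s * (g.len y ^ (n : ℝ) * (∑ y' : g.Site, Hk.e n U y y' * g.len y' ^ (d : ℝ)) * ‖b‖) := by
        rw [Real.rpow_add hl]; ring
    _ ≤ g.len y ^ s * (C * c * ‖b‖) := mul_le_mul_of_nonneg_left hn (Real.rpow_nonneg hl.le _)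
    _ ≤ 1 * (C * c * ‖b‖) := mul_le_mul_of_nonneg_right (hls y) hCcb
    _ = C * c * ‖b‖ := one_mul _

end OneMember

/-! ## §2 The family: `norm_H₁`'s sentence from `Thm312Printed`'s H-clause and (2.61) at every rate -/

section Family

variable {I : Type} {d : ℕ} {c35 : ℝ} {geo : I → B9.Geometry} {bg : I → B9.Backgrounds} [∀ i, Fintype (geo i).Site]
  {GD G₁ : ∀ i, B9.KernelFamily (geo i) (bg i)} {H H₁ : ∀ i, B9.HKernel (geo i) (bg i)}
  {HasRWExp : ∀ i, B9.KernelFamily (geo i) (bg i) → (bg i).Cfg → ℝ → Prop}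
  {HasRWExpH : ∀ i, B9.HKernel (geo i) (bg i) → (bg i).Cfg → ℝ → Prop}
  {PosDefK : ∀ i, B9.KernelFamily (geo i) (bg i) → (bg i).Cfg → Prop}

/-- ★★ **`norm_H₁` FROM THEOREM 3.12's H-CLAUSE (3.133), THE ROW SUM (2.61) AND THE PIN — GENERIC.**  Data: the ∃-package `B9.Thm312Printed d c35 geo bg GD G₁ H H₁ …`; [4] (2.61) at
every rate under an M-threshold (`RowSum261 geo`); positive scale lengths; a selected H-kernel `Hk i ∈ {H i, H₁ i}` (the clause `∀ Hk ∈ [H i, H₁ i], Ineq3133 d Hk B₀ Bβ δ₀ U ∧ …`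
serves both); a background-indexed family of maps `Hop i U : X i U → Y i U` between seminormed groups read by `Hk i`'s entries through the pin of `opNorm_le_of_ineq3133` (spare
exponent `s`, `len^s ≤ 1`).  Conclusion: `M₄′ := max M₄ M_L(δ₀∕2)`, `a₀`, `B₀′ := B₀·max(c(δ₀∕2), 1) > 0` with `‖Hop i U b‖ ≤ B₀′‖b‖` for every member above the threshold, every
`0 < α₀` with `M·α₀ ≤ a₀`, every `U` in (3.35) ∩ (3.36) and every `b` — the text of `SectEDatum.norm_H₁` ∕ (103) (with `|B|` the sup norm of `b`).
[cite: Balaban1985BackgroundPropagators, Thm 3.12 pp.421-423, (3.133) p.422; Balaban1985Variational, (103) p.293; Balaban1984PropagatorsII, (2.61) p.234] -/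
theorem normH_of_thm312Printed (h312 : B9.Thm312Printed d c35 geo bg GD G₁ H H₁ HasRWExp HasRWExpH PosDefK) (h261 : RowSum261 geo)
    (hlen : ∀ (i : I) (y : (geo i).Site), 0 < (geo i).len y)
    (Hk : ∀ i, B9.HKernel (geo i) (bg i)) (hmem : ∀ i, Hk i = H i ∨ Hk i = H₁ i)
    {X Y : ∀ i : I, (bg i).Cfg → Type} [∀ i U, SeminormedAddCommGroup (X i U)] [∀ i U, SeminormedAddCommGroup (Y i U)]
    (Hop : ∀ (i : I) (U : (bg i).Cfg), X i U → Y i U) (s : ℝ) (hls : ∀ (i : I) (y : (geo i).Site), (geo i).len y ^ s ≤ 1)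
    (hpin : ∀ (i : I) (U : (bg i).Cfg) (b : X i U) (c : ℝ), 0 ≤ c →
      (∀ (n : Fin 2) (y : (geo i).Site),
          (geo i).len y ^ ((n : ℝ) + s) * (∑ y' : (geo i).Site, (Hk i).e n U y y' * (geo i).len y' ^ (d : ℝ)) * ‖b‖ ≤ c) →
        ‖Hop i U b‖ ≤ c) :
    ∃ M₄ a₀ B₀ : ℝ, 0 < M₄ ∧ 0 < a₀ ∧ 0 < B₀ ∧
      ∀ i : I, M₄ ≤ (geo i).M → ∀ α₀ : ℝ, 0 < α₀ → (geo i).M * α₀ ≤ a₀ →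
        ∀ U : (bg i).Cfg, (bg i).Reg335 c35 α₀ U → (bg i).Reg336 c35 α₀ U → ∀ b : X i U, ‖Hop i U b‖ ≤ B₀ * ‖b‖ := by
  obtain ⟨M₄, δ₀, a₀, B₀, Bβ, _Bε, _Bεβ, hM₄, hδ₀, ha₀, hB₀, h⟩ := h312
  obtain ⟨ML, c, hc⟩ := h261 (δ₀ / 2) (half_pos hδ₀)
  refine ⟨max M₄ ML, a₀, B₀ * max c 1, lt_max_iff.2 (Or.inl hM₄), ha₀, mul_pos hB₀ (lt_max_iff.2 (Or.inr one_pos)),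
    fun i hM α₀ hα₀ hMa U hU hU' b => ?_⟩
  have hM4 : M₄ ≤ (geo i).M := (le_max_left _ _).trans hM
  have hMl : ML ≤ (geo i).M := (le_max_right _ _).trans hM
  have hmemL : Hk i ∈ [H i, H₁ i] := by
    rcases hmem i with hk | hk <;> simp [hk]
  have h3133 : B9.Ineq3133 d (Hk i) B₀ Bβ δ₀ U := ((h i hM4 α₀ hα₀ hMa U hU hU').2 (Hk i) hmemL).1
  have hrow : ∀ y : (geo i).Site, ∑ y' : (geo i).Site, Real.exp (-(δ₀ / 2 * (geo i).dist y y')) ≤ max c 1 :=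
    fun y => (hc i hMl y).trans (le_max_left _ _)
  exact opNorm_le_of_ineq3133 h3133 hB₀.le (hlen i) (zero_le_one.trans (le_max_right _ _)) hrow (Hop i U) s (hls i) (hpin i U) b

/-- ★ **The same in the (115) letters, from the two POINTWISE pins** ((115) verbatim, `s = 1`): `Y i U := Space115 (Lr i) (η i) (lev₀ i) (lev₁ i) (D i U)` (the jet space of
[Balaban1985Variational] (115) at the background's covariant derivative `D i U`), output points `x` (resp. gradient points `p`) attached to their coarse site by `σ₀ i` (resp. `σ₁ i`)
— print's «x ∈ Δ(y), y ∈ Λ_j» —, and the pins: `(L^{j(x)}η)·‖(H b)(x)‖ ≤ len(σ₀ x)·Σ_{y′} Hk.e 0 U (σ₀ x) y′·len(y′)^d·‖b‖` and `(L^{j(p)}η)²·‖(∇_U H b)(p)‖ ≤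
len(σ₁ p)²·Σ_{y′} Hk.e 1 U (σ₁ p) y′·len(y′)^d·‖b‖` (the weight of a point IS its block's scale length, the value is dominated entry by entry), plus `len ≤ 1` (`L^{j}η ≤ 1`, j ≤ k).
[cite: Balaban1985Variational, (115) p.294, (103) p.293; Balaban1985BackgroundPropagators, (3.133) p.422; Balaban1984PropagatorsII, (2.61) p.234] -/
theorem normH_of_thm312Printed_jet (h312 : B9.Thm312Printed d c35 geo bg GD G₁ H H₁ HasRWExp HasRWExpH PosDefK) (h261 : RowSum261 geo)
    (hlen : ∀ (i : I) (y : (geo i).Site), 0 < (geo i).len y) (hlen1 : ∀ (i : I) (y : (geo i).Site), (geo i).len y ≤ 1)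
    (Hk : ∀ i, B9.HKernel (geo i) (bg i)) (hmem : ∀ i, Hk i = H i ∨ Hk i = H₁ i)
    {X : ∀ i : I, (bg i).Cfg → Type} [∀ i U, SeminormedAddCommGroup (X i U)]
    {V : Type} [NormedAddCommGroup V] [NormedSpace ℂ V] {P₀ P₁ : I → Type} [∀ i, Fintype (P₀ i)] [∀ i, Fintype (P₁ i)]
    (Lr η : I → ℝ) [∀ i, Fact (0 < Lr i)] [∀ i, Fact (0 < η i)] (lev₀ : ∀ i, P₀ i → ℕ) (lev₁ : ∀ i, P₁ i → ℕ)
    (D : ∀ (i : I) (_U : (bg i).Cfg), (P₀ i → V) →ₗ[ℂ] (P₁ i → V))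
    (Hop : ∀ (i : I) (U : (bg i).Cfg), X i U → Space115 (Lr i) (η i) (lev₀ i) (lev₁ i) (D i U))
    (σ₀ : ∀ i : I, P₀ i → (geo i).Site) (σ₁ : ∀ i : I, P₁ i → (geo i).Site)
    (hpin0 : ∀ (i : I) (U : (bg i).Cfg) (b : X i U) (x : P₀ i),
      levWeight (Lr i) (η i) (lev₀ i) 1 x * ‖JetSup.equiv (levWeight (Lr i) (η i) (lev₀ i) 1) (levWeight (Lr i) (η i) (lev₁ i) 2) (D i U) (Hop i U b) x‖ ≤
        (geo i).len (σ₀ i x) ^ (1 : ℝ) * (∑ y' : (geo i).Site, (Hk i).e 0 U (σ₀ i x) y' * (geo i).len y' ^ (d : ℝ)) * ‖b‖)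
    (hpin1 : ∀ (i : I) (U : (bg i).Cfg) (b : X i U) (p : P₁ i),
      levWeight (Lr i) (η i) (lev₁ i) 2 p * ‖D i U (JetSup.equiv (levWeight (Lr i) (η i) (lev₀ i) 1) (levWeight (Lr i) (η i) (lev₁ i) 2) (D i U) (Hop i U b)) p‖ ≤
        (geo i).len (σ₁ i p) ^ (2 : ℝ) * (∑ y' : (geo i).Site, (Hk i).e 1 U (σ₁ i p) y' * (geo i).len y' ^ (d : ℝ)) * ‖b‖) :
    ∃ M₄ a₀ B₀ : ℝ, 0 < M₄ ∧ 0 < a₀ ∧ 0 < B₀ ∧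
      ∀ i : I, M₄ ≤ (geo i).M → ∀ α₀ : ℝ, 0 < α₀ → (geo i).M * α₀ ≤ a₀ →
        ∀ U : (bg i).Cfg, (bg i).Reg335 c35 α₀ U → (bg i).Reg336 c35 α₀ U →
          ∀ b : X i U, ‖Hop i U b‖ ≤ B₀ * ‖b‖ := by
  refine normH_of_thm312Printed h312 h261 hlen Hk hmem Hop 1 (fun i y => by rw [Real.rpow_one]; exact hlen1 i y) fun i U b c hc hall => ?_
  have e0 : (((0 : Fin 2) : ℕ) : ℝ) + 1 = 1 := by norm_num
  have e1 : (((1 : Fin 2) : ℕ) : ℝ) + 1 = 2 := by norm_num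
  refine (JetSup.norm_le_iff_pointwise (f := Hop i U b) hc).2 ⟨fun x => (hpin0 i U b x).trans ?_, fun p => (hpin1 i U b p).trans ?_⟩
  · have h0 := hall 0 (σ₀ i x)
    rw [e0] at h0
    exact h0
  · have h1 := hall 1 (σ₁ i p)
    rw [e1] at h1
    exact h1

end Family

/-! ## §3 At the T³ member of record: the displayed `norm_H₁` row's shape through the class-transfer row -/

section T3

variable {ℓ : ℕ} {hL : Odd (ℓ + 1) ∧ 1 < ℓ + 1} {c35 : ℝ}
  {GD G₁ : ∀ i : KIdx 2 ℓ hd3 hL 1 1, B9.KernelFamily (geo9K i) (bgT3 i)} {Hk H₁k : ∀ i : KIdx 2 ℓ hd3 hL 1 1, B9.HKernel (geo9K i) (bgT3 i)}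
  {HasRWExp : ∀ i : KIdx 2 ℓ hd3 hL 1 1, B9.KernelFamily (geo9K i) (bgT3 i) → (bgT3 i).Cfg → ℝ → Prop}
  {HasRWExpH : ∀ i : KIdx 2 ℓ hd3 hL 1 1, B9.HKernel (geo9K i) (bgT3 i) → (bgT3 i).Cfg → ℝ → Prop}
  {PosDefK : ∀ i : KIdx 2 ℓ hd3 hL 1 1, B9.KernelFamily (geo9K i) (bgT3 i) → (bgT3 i).Cfg → Prop}

/-- ★★ **THE DISPLAYED `norm_H₁` ROW AT THE T³ MEMBER OF RECORD FROM `Thm312Printed` ∧ `ClassTransferT3` ∧ THE PIN.**  At the index `KIdx 2 ℓ hd3 hL 1 1` (★w3-20520 g2),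
geometry `geo9K`, backgrounds `bgT3` (★w1 g2): `B9.Thm312Printed (2+1) c35 geo9K bgT3 GD G₁ Hk H₁k …` (the conclusion of ✓ `Prop7SectET3N06LeavesRecordH.t312_of_pins_T3_completePairMBZ`),
the class-transfer row `ClassTransferT3 ℓ hL c35`, a selected H-kernel `Hsel i ∈ {Hk i, H₁k i}` and an operator family `Hop i U : X i U → Y i U` read by `Hsel i`'s (3.133) entries
through the pin (spare exponent `s`, `len^s ≤ 1`) give `M₄, a₀, B₀ > 0` such that for every member `memberIdx ℓ hL hℓ m hm n K a' R …` with `M₄ ≤ L·L^{a'}`, every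
`e ≤ a₀∕(L·L^{a'})` and every SU(2) field `U₀` of the member's torus in print's regular space `RegPr ⟨ℓ+1, hL, m, hm⟩ n K e U₀`:  `‖Hop (memberIdx …) (cfgV1OfT3 U₀) b‖ ≤ B₀‖b‖` for
all `b` — the displayed `norm_H₁` row of `Cmin_of_P6T3_chart_growth_pd` in its own shape (`RegPr … e U₀ → e ≤ α → …`, `α = a₀∕(L·L^{a'})` member-uniform once `a'` is fixed).
DISCHARGED inside: (Σ) = [4] (2.61) at every rate by `rowSum261_geo9K`; `0 < L^{j}η` by `geoOK_geo9K`; `RegPr e ⊂ RegPr α` (`regPr_mono`), `α = L³·1·(α∕L³)` for the class-transfer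
row, `M·α = a₀`.  The twin of ✓ `Prop7SectET3NormG.normG_row_of_t313_classTransfer`. [cite: Balaban1985Variational, (103) p.293, (14) p.280; Balaban1985BackgroundPropagators, Thm 3.12 pp.421-423, (3.133) p.422; Balaban1984PropagatorsII, (2.61) p.234; Balaban1985RegularSpaces, (1.33) p.82] -/
theorem normH₁_row_of_t312_classTransfer [∀ i : KIdx 2 ℓ hd3 hL 1 1, Fintype (geo9K i).Site]
    (h312 : B9.Thm312Printed (2 + 1) c35 geo9K bgT3 GD G₁ Hk H₁k HasRWExp HasRWExpH PosDefK) (hCT : ClassTransferT3 ℓ hL c35)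
    (Hsel : ∀ i : KIdx 2 ℓ hd3 hL 1 1, B9.HKernel (geo9K i) (bgT3 i)) (hmem : ∀ i, Hsel i = Hk i ∨ Hsel i = H₁k i)
    {X Y : ∀ i : KIdx 2 ℓ hd3 hL 1 1, (bgT3 i).Cfg → Type} [∀ i U, SeminormedAddCommGroup (X i U)] [∀ i U, SeminormedAddCommGroup (Y i U)]
    (Hop : ∀ (i : KIdx 2 ℓ hd3 hL 1 1) (U : (bgT3 i).Cfg), X i U → Y i U) (s : ℝ)
    (hls : ∀ (i : KIdx 2 ℓ hd3 hL 1 1) (y : (geo9K i).Site), (geo9K i).len y ^ s ≤ 1)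
    (hpin : ∀ (i : KIdx 2 ℓ hd3 hL 1 1) (U : (bgT3 i).Cfg) (b : X i U) (c : ℝ), 0 ≤ c →
      (∀ (n : Fin 2) (y : (geo9K i).Site),
          (geo9K i).len y ^ ((n : ℝ) + s) * (∑ y' : (geo9K i).Site, (Hsel i).e n U y y' * (geo9K i).len y' ^ ((2 + 1 : ℕ) : ℝ)) * ‖b‖ ≤ c) →
        ‖Hop i U b‖ ≤ c) :
    ∃ M₄ a₀ B₀ : ℝ, 0 < M₄ ∧ 0 < a₀ ∧ 0 < B₀ ∧
      ∀ (hℓ : 4 ≤ ℓ) (m : ℕ) (hm : 1 ≤ m) (n K a' R : ℕ) (hk1 : 1 ≤ K - n) (hsize : a' + 3 ≤ m + n) (hM8 : 8 ≤ (ℓ + 1) ^ a') (hR2 : 2 * (ℓ + 1) ^ 2 ≤ R),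
        M₄ ≤ ((ℓ + 1 : ℕ) : ℝ) * (((ℓ + 1) ^ a' : ℕ) : ℝ) →
        ∀ (e : ℝ) (U₀ : GaugeField (PV 2 ℓ m K hd3 hL) 0 (Matrix.specialUnitaryGroup (Fin 2) ℂ)),
          RegPr (⟨ℓ + 1, hL, m, hm⟩ : T3Family) n K e U₀ → e ≤ a₀ / (((ℓ + 1 : ℕ) : ℝ) * (((ℓ + 1) ^ a' : ℕ) : ℝ)) →
            ∀ b : X (memberIdx ℓ hL hℓ m hm n K a' R hk1 hsize hM8 hR2) (cfgV1OfT3 U₀),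
              ‖Hop (memberIdx ℓ hL hℓ m hm n K a' R hk1 hsize hM8 hR2) (cfgV1OfT3 U₀) b‖ ≤ B₀ * ‖b‖ := by
  obtain ⟨M₄, a₀, B₀, hM₄, ha₀, hB₀, h⟩ :=
    normH_of_thm312Printed h312 rowSum261_geo9K (fun i => (geoOK_geo9K i).lenpos) Hsel hmem Hop s hls hpin
  refine ⟨M₄, a₀, B₀, hM₄, ha₀, hB₀, fun hℓ m hm n K a' R hk1 hsize hM8 hR2 hM e U₀ hreg he b => ?_⟩
  set i := memberIdx ℓ hL hℓ m hm n K a' R hk1 hsize hM8 hR2 with hi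
  have hMpos : 0 < ((ℓ + 1 : ℕ) : ℝ) * (((ℓ + 1) ^ a' : ℕ) : ℝ) := by positivity
  have hL3 : 0 < ((ℓ + 1 : ℕ) : ℝ) ^ 3 := by positivity
  -- the member-uniform radius `α = a₀ / M` and its class-transfer form `L³·1·(α/L³)`
  set α : ℝ := a₀ / (((ℓ + 1 : ℕ) : ℝ) * (((ℓ + 1) ^ a' : ℕ) : ℝ)) with hα
  have hαpos : 0 < α := div_pos ha₀ hMpos
  have hαeq : ((ℓ + 1 : ℕ) : ℝ) ^ 3 * 1 * (α / ((ℓ + 1 : ℕ) : ℝ) ^ 3) = α := by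
    field_simp
  have hreg' : RegPr (⟨ℓ + 1, hL, m, hm⟩ : T3Family) n K (((ℓ + 1 : ℕ) : ℝ) ^ 3 * 1 * (α / ((ℓ + 1 : ℕ) : ℝ) ^ 3)) U₀ := by
    rw [hαeq]
    exact regPr_mono _ he hreg
  have hcls := hCT hℓ m hm n K a' R hk1 hsize hM8 hR2 1 (α / ((ℓ + 1 : ℕ) : ℝ) ^ 3) one_pos (div_pos hαpos hL3) U₀ hreg'
  rw [hαeq] at hcls
  have hMα : (geo9K i).M * α ≤ a₀ := by
    rw [hi, geo9K_M_memberIdx, hα, mul_div_cancel₀ _ hMpos.ne']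
  exact h i (by rw [hi, geo9K_M_memberIdx]; exact hM) α hαpos hMα (cfgV1OfT3 U₀) hcls.1 hcls.2 b

end T3

end Summit.QuantumFields.YangMills.Theorems.Prop7SectET3NormH1

end
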